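import Literature.Geometry.Symplectic.LegendrianDarbouxBox
import Literature.Geometry.Symplectic.BoundaryChartImmersion
import Literature.Geometry.Symplectic.SteinBoundaryContactProofs
import Literature.Geometry.Symplectic.SteinLiouville
import Literature.Geometry.Symplectic.TwistingHomotopyProofs
import HarnessLib

/-!
# The Darboux data of a Legendrian arc in the boundary of a Stein domain

Topic `Literature/Geometry/Symplectic`; infrastructure (brick **T1**, chart layer) for the proof of
the named fact `Literature.Geometry.Symplectic.Gompf1998_addLeftTwists` (`LegendrianRealisation.lean`;
Gompf 1998, §1).  `LegendrianDarbouxBox.lean` builds Darboux coordinates `Ψ^*α = g (dz - y dx)`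
along a Legendrian arc from Euclidean data (`LegendrianDarboux.DarbouxData`); this file produces
that data from a Legendrian knot `K` in the boundary `∂W` of a compact Stein domain
(`SteinStructure W`) and a base parameter `s₀`, everything read in the ONE extended chart at the
base point `p = K (circlePt s₀)`.  Everything is **proved**; no named facts.

## Contents (namespace `Literature.Geometry.Symplectic.LegendrianDarboux`)

* `isBoundaryPoint_iff_apply_zero` — in a boundary chart, boundary points of its source are the
  points with vanishing `0`-th coordinate (Mathlib's boundary invariance
  `ModelWithCorners.isBoundaryPoint_iff_of_mem_atlas`, frontiers being local);
* `LegendrianArc S` (`K`, `legendrian`, `s₀`) and, for `A : LegendrianArc S`: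
  - `A.emb w = chart p + (0, w)` — the affine parametrisation of the boundary hyperplane through
    `chart p` by `ℝ³`, `A.U = emb ⁻¹' (chart target)` (open, `0 ∈ U`);
  - `αM S = -d^ℂφ` (the contact form as a `1`-form), `A.αhat` its chart representative
    (`MForm.inChart`), `C^∞` within the half-space on the chart target (`IsSmoothForm`), and
    **`A.αc w v = α̂_{emb w}(0, v)`**, a smooth field of functionals on `U` (`contDiffOn_αc`);
  - the arc `A.chat s = proj3 (chart (K (circlePt s))) - proj3 (chart p)` on a parameter interval
    `A.Iv` around `s₀` on which `K` stays in the chart source: smooth, `emb ∘ ĉ = chart ∘ K ∘ circlePt`,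
    and **Legendrian for `αc`** (`αc_chat_deriv`: the velocity read in the chart is the tangent
    coordinate change of `ċ`, `tangentCoordChange_knotVelocity`, and `α(ċ) = 0`,
    `MForm.apply_eq_inChart_apply`);
  - `A.u₀ = proj3 (J ċ(s₀))` with `αc₀(u₀) = 0` (`J ċ ∈ ξ`), `A.r₀` with `αc₀(r₀) > 0`
    (`exists_contactForm_pos`: `T∂W` is `3`-dimensional, the contact plane `2`-dimensional);
  - **the contact condition** `twist_pos : 0 < dαc₀(ĉ'(s₀), u₀) = ω_p(ċ, Jċ)`
    (`kahlerForm_eq_extDerivWithin`: `ω = d(-d^ℂφ)` read in the chart by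
    `inChart_mextDeriv_of_mem_target`; naturality of `d` under the affine embedding,
    Mathlib's `extDerivWithin_pullback`; `J`-convexity `ω(v, Jv) > 0`);
  - `A.darbouxData : DarbouxData` assembling the above.

## References

* R. E. Gompf, *Handlebody construction of Stein surfaces*, Ann. of Math. 148 (1998), §1.
  [Gompf1998]
* K. Cieliebak, Ya. Eliashberg, *From Stein to Weinstein and back* (2012), Ch. 2 (the contact
  structure of a `J`-convex boundary). [CieliebakEliashberg2012]
-/

noncomputable section

open scoped Manifold ContDiff Topology
open Set Function Metric
open Literature.Geometry.Kaehler Literature.Topology.FourManifolds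

namespace Literature.Geometry.Symplectic

/-- `ℝ⁴`, the model of the tangent spaces. -/
local notation "E4" => EuclideanSpace ℝ (Fin 4)
/-- `ℝ³`. -/
local notation "E3" => EuclideanSpace ℝ (Fin 3)
/-- The unit sphere `𝕊ⁿ`. -/
local notation "𝕊 " n:arg => (Metric.sphere (0 : EuclideanSpace ℝ (Fin (n + 1))) 1)

namespace LegendrianDarboux

/-! ### Boundary points in a boundary chart -/

/-- Frontiers are local: inside an open set `A`, the frontier of `A ∩ B` is that of `B`.
[folklore] -/
theorem mem_frontier_inter_iff_of_isOpen {X : Type*} [TopologicalSpace X] {A B : Set X} {y : X}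
    (hA : IsOpen A) (hy : y ∈ A) : y ∈ frontier (A ∩ B) ↔ y ∈ frontier B := by
  simp only [frontier, mem_sdiff, interior_inter, hA.interior_eq, mem_inter_iff, hy, true_and]
  refine and_congr_left fun _ => ?_
  simp only [mem_closure_iff_nhds]
  constructor
  · intro h U hU
    obtain ⟨x, hx⟩ := h U hU
    exact ⟨x, hx.1, hx.2.2⟩
  · intro h U hU
    obtain ⟨x, hx⟩ := h (U ∩ A) (Filter.inter_mem hU (hA.mem_nhds hy))
    exact ⟨x, hx.1.1, hx.1.2, hx.2⟩

variable {W : Type*} [TopologicalSpace W] [ChartedSpace (EuclideanHalfSpace 4) W]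
  [IsManifold (𝓡∂ 4) ∞ W]

/-- In the chart at `p`, boundary points of its source are the points with vanishing `0`-th
coordinate (boundary invariance, Mathlib's `isBoundaryPoint_iff_of_mem_atlas`). [folklore] -/
theorem isBoundaryPoint_iff_apply_zero {p z : W} (hz : z ∈ (chartAt (EuclideanHalfSpace 4) p).source) :
    (𝓡∂ 4).IsBoundaryPoint z ↔ (extChartAt (𝓡∂ 4) p z) 0 = 0 := by
  rw [(𝓡∂ 4).isBoundaryPoint_iff_of_mem_atlas (n := ∞) (by simp) (chart_mem_atlas _ p) hz]
  change (extChartAt (𝓡∂ 4) p z) ∈ frontier (extChartAt (𝓡∂ 4) p).target ↔ _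
  have hy : extChartAt (𝓡∂ 4) p z ∈ (extChartAt (𝓡∂ 4) p).target :=
    (extChartAt (𝓡∂ 4) p).map_source (by rwa [extChartAt_source])
  rw [extChartAt_target] at hy ⊢
  set A : Set E4 := (𝓡∂ 4).symm ⁻¹' (chartAt (EuclideanHalfSpace 4) p).target with hA
  have hAo : IsOpen A := (chartAt (EuclideanHalfSpace 4) p).open_target.preimage (𝓡∂ 4).continuous_symm
  rw [mem_frontier_inter_iff_of_isOpen hAo hy.1, frontier_range_modelWithCornersEuclideanHalfSpace]
  exact ⟨fun h => h.symm, fun h => h.symm⟩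

/-! ### A Legendrian knot with a base parameter, read in the chart at the base point -/

variable [CompactSpace W]

/-- **A Legendrian knot of the boundary of a Stein domain together with a base parameter `s₀`**
(the arc to be stabilised is around `K (circlePt s₀)`). [folklore] -/
structure LegendrianArc (S : SteinStructure W) where
  /-- the knot -/
  K : 𝕊 1 → W
  /-- it is Legendrian -/
  legendrian : IsLegendrianKnot S.J K
  /-- the base parameter -/
  s₀ : ℝ

namespace LegendrianArc

variable {S : SteinStructure W} (A : LegendrianArc S)

/-- The base point `p = K(circlePt s₀)`. [folklore] -/
def p : W := A.K (circlePt A.s₀)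

/-- The extended chart at the base point. [folklore] -/
def chart : PartialEquiv W E4 := extChartAt (𝓡∂ 4) A.p

/-- Unfolding `chart`. [folklore] -/
theorem chart_def : A.chart = extChartAt (𝓡∂ 4) A.p := rfl

/-- The base point is a boundary point. [folklore] -/
theorem isBoundaryPoint_p : (𝓡∂ 4).IsBoundaryPoint A.p := A.legendrian.isBoundaryPoint _

/-- The base point lies in its chart source. [folklore] -/
theorem p_mem_source : A.p ∈ (chartAt (EuclideanHalfSpace 4) A.p).source := mem_chart_source _ _

/-- The base point has vanishing `0`-th chart coordinate. [folklore] -/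
theorem chart_p_zero : A.chart A.p 0 = 0 :=
  (isBoundaryPoint_iff_apply_zero A.p_mem_source).1 A.isBoundaryPoint_p

/-- **The affine parametrisation of the boundary hyperplane through the base point**:
`emb w = chart p + (0, w)`. [folklore] -/
def emb (w : E3) : E4 := A.chart A.p + L3 w

/-- `emb 0 = chart p`. [folklore] -/
@[simp] theorem emb_zero : A.emb 0 = A.chart A.p := by simp [emb]

/-- The hyperplane points have vanishing `0`-th coordinate. [folklore] -/
theorem emb_apply_zero (w : E3) : A.emb w 0 = 0 := by
  simp [emb, A.chart_p_zero]

/-- The hyperplane lies in the closed half-space `range (𝓡∂ 4)`. [folklore] -/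
theorem emb_mem_range (w : E3) : A.emb w ∈ range (𝓡∂ 4) := by
  rw [range_modelWithCornersEuclideanHalfSpace]
  exact le_of_eq (A.emb_apply_zero w).symm

/-- The derivative of `emb` is `L3`. [folklore] -/
theorem hasFDerivAt_emb (w : E3) : HasFDerivAt A.emb L3 w := by
  show HasFDerivAt (fun w => A.chart A.p + L3 w) L3 w
  exact (L3.hasFDerivAt (x := w)).const_add (A.chart A.p)

/-- `emb` is smooth. [folklore] -/
theorem contDiff_emb : ContDiff ℝ ∞ A.emb := contDiff_const.add L3.contDiff

/-- `emb` is continuous. [folklore] -/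
theorem continuous_emb : Continuous A.emb := A.contDiff_emb.continuous

/-- `emb` is injective. [folklore] -/
theorem emb_injective : Injective A.emb := fun _ _ h => L3_injective (add_left_cancel h)

/-- `proj3 ∘ emb` recovers the parameter. [folklore] -/
@[simp] theorem proj3_emb_sub (w : E3) : proj3 (A.emb w) - proj3 (A.chart A.p) = w := by
  simp [emb, map_add]

/-- **The domain `U`**: parameters whose hyperplane point lies in the chart target. [folklore] -/
def U : Set E3 := A.emb ⁻¹' A.chart.target

/-- `U` is open. [folklore] -/
theorem isOpen_U : IsOpen A.U := by
  have h : A.U = A.emb ⁻¹' ((𝓡∂ 4).symm ⁻¹' (chartAt (EuclideanHalfSpace 4) A.p).target) := by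
    ext w
    simp only [U, chart, extChartAt_target, mem_preimage, mem_inter_iff, A.emb_mem_range w, and_true]
  rw [h]
  exact ((chartAt (EuclideanHalfSpace 4) A.p).open_target.preimage (𝓡∂ 4).continuous_symm).preimage
    A.continuous_emb

/-- `0 ∈ U`. [folklore] -/
theorem zero_mem_U : (0 : E3) ∈ A.U := by
  simp only [U, mem_preimage, emb_zero, chart]
  exact mem_extChartAt_target _

/-- Points of `U` embed into the chart target. [folklore] -/
theorem emb_mem_target {w : E3} (hw : w ∈ A.U) : A.emb w ∈ A.chart.target := hw

/-- Points of `U` come from the chart source. [folklore] -/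
theorem symm_emb_mem_source {w : E3} (hw : w ∈ A.U) :
    A.chart.symm (A.emb w) ∈ (chartAt (EuclideanHalfSpace 4) A.p).source := by
  have := A.chart.map_target hw
  rwa [chart, extChartAt_source] at this

/-! ### The contact form read in the chart -/

/-- The contact form `α = -d^ℂφ` as a `1`-form. [folklore] -/
def αM (S : SteinStructure W) : MForm (𝓡∂ 4) W ℝ 1 := -dComplex S.J S.φ

/-- `αM` evaluated is the contact form. [folklore] -/
theorem αM_apply (x : W) (v : E4) : αM S x ![v] = S.contactForm x v := rfl

/-- The chart representative `α̂` of the contact form in the chart at the base point. [folklore] -/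
def αhat : E4 → E4 [⋀^Fin 1]→L[ℝ] ℝ := (αM S).inChart A.p

/-- **The contact form on `ℝ³`**: `αc w v = α̂_{emb w}(0, v)`. [folklore] -/
def αc (w : E3) : E3 →L[ℝ] ℝ :=
  (ContinuousAlternatingMap.ofSubsingleton ℝ E3 ℝ (0 : Fin 1)).symm
    ((A.αhat (A.emb w)).compContinuousLinearMap L3)

/-- `αc`, evaluated. [folklore] -/
theorem αc_apply (w v : E3) : A.αc w v = A.αhat (A.emb w) ![L3 v] := by
  rw [αc, ContinuousAlternatingMap.ofSubsingleton_symm_apply_apply,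
    ContinuousAlternatingMap.compContinuousLinearMap_apply]
  congr 1
  funext i; fin_cases i; rfl

/-- `αc` through Mathlib's linear isometries (for smoothness). [folklore] -/
theorem αc_eq (w : E3) : A.αc w =
    (ContinuousAlternatingMap.ofSubsingletonLIE (𝕜 := ℝ) (E := E3) (F := ℝ) (ι := Fin 1) 0).symm
      (ContinuousAlternatingMap.compContinuousLinearMapCLM L3 (A.αhat (A.emb w))) := rfl

/-! ### The arc read in the chart -/

/-- A parameter interval around `s₀` on which the knot stays in the chart source. [folklore] -/
theorem exists_δ : ∃ δ > (0 : ℝ), ∀ s ∈ Ioo (A.s₀ - δ) (A.s₀ + δ),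
    A.K (circlePt s) ∈ (chartAt (EuclideanHalfSpace 4) A.p).source := by
  have hc : Continuous fun s => A.K (circlePt s) :=
    A.legendrian.isSmoothEmbedding.contMDiff.continuous.comp continuous_circlePt
  have hmem : (fun s => A.K (circlePt s)) ⁻¹' (chartAt (EuclideanHalfSpace 4) A.p).source ∈ 𝓝 A.s₀ :=
    hc.continuousAt.preimage_mem_nhds ((chartAt _ A.p).open_source.mem_nhds A.p_mem_source)
  obtain ⟨δ, hδ, hsub⟩ := Metric.mem_nhds_iff.1 hmem
  refine ⟨δ, hδ, fun s hs => hsub ?_⟩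
  rw [Metric.mem_ball, Real.dist_eq, abs_lt]
  constructor <;> linarith [hs.1, hs.2]

/-- The half-length of the parameter interval. [folklore] -/
def δ : ℝ := Classical.choose A.exists_δ

/-- `δ > 0`. [folklore] -/
theorem δ_pos : 0 < A.δ := (Classical.choose_spec A.exists_δ).1

/-- The parameter interval. [folklore] -/
def Iv : Set ℝ := Ioo (A.s₀ - A.δ) (A.s₀ + A.δ)

/-- The parameter interval is open. [folklore] -/
theorem isOpen_Iv : IsOpen A.Iv := isOpen_Ioo

/-- `s₀` lies in the parameter interval. [folklore] -/
theorem s₀_mem_Iv : A.s₀ ∈ A.Iv := ⟨by linarith [A.δ_pos], by linarith [A.δ_pos]⟩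

/-- On the parameter interval the knot stays in the chart source. [folklore] -/
theorem mem_source_of_mem_Iv {s : ℝ} (hs : s ∈ A.Iv) :
    A.K (circlePt s) ∈ (chartAt (EuclideanHalfSpace 4) A.p).source :=
  (Classical.choose_spec A.exists_δ).2 s hs

/-- On the parameter interval the knot stays in the extended chart source. [folklore] -/
theorem mem_extSource_of_mem_Iv {s : ℝ} (hs : s ∈ A.Iv) :
    A.K (circlePt s) ∈ (extChartAt (𝓡∂ 4) A.p).source := by
  rw [extChartAt_source]; exact A.mem_source_of_mem_Iv hs

/-- The knot read in the chart: `γ s = chart (K (circlePt s))`. [folklore] -/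
def γ (s : ℝ) : E4 := A.chart (A.K (circlePt s))

/-- **The arc in `ℝ³`**: `ĉ s = proj3 (γ s) - proj3 (chart p)`. [folklore] -/
def chat (s : ℝ) : E3 := proj3 (A.γ s) - proj3 (A.chart A.p)

/-- `ĉ(s₀) = 0`. [folklore] -/
@[simp] theorem chat_s₀ : A.chat A.s₀ = 0 := by simp [chat, γ, p]

/-- `γ` lies in the boundary hyperplane. [folklore] -/
theorem γ_apply_zero {s : ℝ} (hs : s ∈ A.Iv) : A.γ s 0 = 0 :=
  (isBoundaryPoint_iff_apply_zero (A.mem_source_of_mem_Iv hs)).1 (A.legendrian.isBoundaryPoint _)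

/-- On the parameter interval, `emb ∘ ĉ = γ`. [folklore] -/
theorem emb_chat {s : ℝ} (hs : s ∈ A.Iv) : A.emb (A.chat s) = A.γ s := by
  have h0 := A.γ_apply_zero hs
  have hp := A.chart_p_zero
  refine euclidean_four_ext ?_ ?_ ?_ ?_ <;> simp [emb, chat, map_sub, h0, hp]

/-- The arc lies in `U`. [folklore] -/
theorem chat_mem_U {s : ℝ} (hs : s ∈ A.Iv) : A.chat s ∈ A.U := by
  show A.emb (A.chat s) ∈ A.chart.target
  rw [A.emb_chat hs]
  exact A.chart.map_source (A.mem_extSource_of_mem_Iv hs)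

/-- `γ` is smooth on the parameter interval. [folklore] -/
theorem contDiffAt_γ {s : ℝ} (hs : s ∈ A.Iv) : ContDiffAt ℝ ∞ A.γ s := by
  have h1 : ContMDiffAt 𝓘(ℝ, ℝ) (𝓡∂ 4) ∞ (fun s => A.K (circlePt s)) s :=
    (A.legendrian.isSmoothEmbedding.contMDiff.comp contMDiff_circlePt).contMDiffAt
  have h2 : ContMDiffAt (𝓡∂ 4) 𝓘(ℝ, E4) ∞ (extChartAt (𝓡∂ 4) A.p) (A.K (circlePt s)) :=
    contMDiffAt_extChartAt' (A.mem_source_of_mem_Iv hs)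
  exact (h2.comp s h1).contDiffAt

/-- The arc is smooth. [folklore] -/
theorem contDiffAt_chat {s : ℝ} (hs : s ∈ A.Iv) : ContDiffAt ℝ ∞ A.chat s :=
  (proj3.contDiff.contDiffAt.comp s (A.contDiffAt_γ hs)).sub contDiffAt_const

/-- The arc is smooth on the parameter interval. [folklore] -/
theorem contDiffOn_chat : ContDiffOn ℝ ∞ A.chat A.Iv := fun _ hs => (A.contDiffAt_chat hs).contDiffWithinAt

/-- **The velocity read in the chart**: the tangent coordinate change to the chart at `p` sends
the velocity `ċ(s)` of the knot to the derivative of `γ`. [folklore] -/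
theorem tangentCoordChange_knotVelocity {s : ℝ} (hs : s ∈ A.Iv) :
    tangentCoordChange (𝓡∂ 4) (A.K (circlePt s)) A.p (A.K (circlePt s)) (knotVelocity A.K s) =
      deriv A.γ s := by
  have hsrc := A.mem_source_of_mem_Iv hs
  have hKc : MDifferentiableAt 𝓘(ℝ, ℝ) (𝓡∂ 4) (A.K ∘ circlePt) s :=
    ((A.legendrian.isSmoothEmbedding.contMDiff.comp contMDiff_circlePt).contMDiffAt).mdifferentiableAt
      (by simp)
  have hch : HasMFDerivAt (𝓡∂ 4) 𝓘(ℝ, E4) (extChartAt (𝓡∂ 4) A.p) (A.K (circlePt s))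
      (tangentCoordChange (𝓡∂ 4) (A.K (circlePt s)) A.p (A.K (circlePt s))) := by
    have h := hasMFDerivAt_extChartAt (I := 𝓡∂ 4) hsrc
    rwa [mfderiv_chartAt_eq_tangentCoordChange (I := 𝓡∂ 4) hsrc] at h
  have hcomp := hch.comp s hKc.hasMFDerivAt
  have hγ : HasMFDerivAt 𝓘(ℝ, ℝ) 𝓘(ℝ, E4) A.γ s
      ((tangentCoordChange (𝓡∂ 4) (A.K (circlePt s)) A.p (A.K (circlePt s))).comp
        (mfderiv 𝓘(ℝ, ℝ) (𝓡∂ 4) (A.K ∘ circlePt) s)) := hcomp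
  have hγ' : HasFDerivAt A.γ
      (((tangentCoordChange (𝓡∂ 4) (A.K (circlePt s)) A.p (A.K (circlePt s)) : E4 →L[ℝ] E4)).comp
        (mfderiv 𝓘(ℝ, ℝ) (𝓡∂ 4) (A.K ∘ circlePt) s : ℝ →L[ℝ] E4)) s := hγ.hasFDerivAt
  rw [hγ'.hasDerivAt.deriv]
  rfl

/-- The derivative of `γ` lies in the hyperplane. [folklore] -/
theorem deriv_γ_apply_zero {s : ℝ} (hs : s ∈ A.Iv) : deriv A.γ s 0 = 0 := by
  have hev : ∀ᶠ t in 𝓝 s, A.γ t 0 = 0 := by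
    filter_upwards [A.isOpen_Iv.mem_nhds hs] with t ht using A.γ_apply_zero ht
  have hd : HasDerivAt (fun t => A.γ t 0) (deriv A.γ s 0) s := by
    have h := ((A.contDiffAt_γ hs).differentiableAt (by simp)).hasDerivAt
    exact (EuclideanSpace.proj (𝕜 := ℝ) (0 : Fin 4)).hasFDerivAt.comp_hasDerivAt s h
  have h0 : HasDerivAt (fun t => A.γ t 0) 0 s :=
    (hasDerivAt_const s (0 : ℝ)).congr_of_eventuallyEq (hev.mono fun t ht => ht)
  exact hd.unique h0

/-- `L3 (ĉ') = γ'`. [folklore] -/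
theorem L3_deriv_chat {s : ℝ} (hs : s ∈ A.Iv) : L3 (deriv A.chat s) = deriv A.γ s := by
  have hd : HasDerivAt A.chat (proj3 (deriv A.γ s)) s := by
    have h := ((A.contDiffAt_γ hs).differentiableAt (by simp)).hasDerivAt
    have h2 := (proj3.hasFDerivAt.comp_hasDerivAt s h).sub_const (proj3 (A.chart A.p))
    exact h2
  rw [hd.deriv, L3_proj3 (A.deriv_γ_apply_zero hs)]

/-- **The arc is Legendrian for `αc`.** [folklore] -/
theorem αc_chat_deriv {s : ℝ} (hs : s ∈ A.Iv) : A.αc (A.chat s) (deriv A.chat s) = 0 := by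
  rw [αc_apply, A.emb_chat hs, A.L3_deriv_chat hs, ← A.tangentCoordChange_knotVelocity hs]
  have h := MForm.apply_eq_inChart_apply (αM S) (I := 𝓡∂ 4) (x₀ := A.p) (A.mem_source_of_mem_Iv hs)
    ![knotVelocity A.K s]
  have h2 : αM S (A.K (circlePt s)) ![knotVelocity A.K s] = 0 := A.legendrian.contactForm_knotVelocity s
  have h3 := h.symm.trans h2
  rw [αhat, γ, chart]
  convert h3 using 2
  funext i; fin_cases i; rfl

/-! ### The vectors `u₀ = J ċ(s₀)` and `r₀` -/

/-- The velocity `V₀ = ċ(s₀)` of the knot at the base point (chart-`p` coordinates). [folklore] -/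
def V₀ : E4 := knotVelocity A.K A.s₀

/-- `ċ(s₀) ≠ 0`. [folklore] -/
theorem V₀_ne_zero : A.V₀ ≠ 0 := knotVelocity_ne_zero A.legendrian.isSmoothEmbedding _

/-- `ċ(s₀) ∈ ξ`. [folklore] -/
theorem V₀_mem : A.V₀ ∈ contactPlane S.J A.p := A.legendrian.knotVelocity_mem _

/-- `J ċ(s₀) ∈ ξ`. [folklore] -/
theorem JV₀_mem : S.J A.p A.V₀ ∈ contactPlane S.J A.p := A.legendrian.J_knotVelocity_mem _

/-- `ċ(s₀)` is tangent to the boundary. [folklore] -/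
theorem V₀_apply_zero : A.V₀ 0 = 0 := A.V₀_mem.1

/-- `J ċ(s₀)` is tangent to the boundary. [folklore] -/
theorem JV₀_apply_zero : S.J A.p A.V₀ 0 = 0 := A.JV₀_mem.1

/-- **`u₀ = J ċ(s₀)`** read in `ℝ³`. [folklore] -/
def u₀ : E3 := proj3 (S.J A.p A.V₀)

/-- `L3 u₀ = J ċ(s₀)`. [folklore] -/
theorem L3_u₀ : L3 A.u₀ = S.J A.p A.V₀ := L3_proj3 A.JV₀_apply_zero

/-- `γ'(s₀) = ċ(s₀)`. [folklore] -/
theorem deriv_γ_s₀ : deriv A.γ A.s₀ = A.V₀ := by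
  rw [← A.tangentCoordChange_knotVelocity A.s₀_mem_Iv]
  exact tangentCoordChange_self (I := 𝓡∂ 4) (mem_extChartAt_source _)

/-- `ĉ'(s₀) = proj3 ċ(s₀)`. [folklore] -/
theorem deriv_chat_s₀ : deriv A.chat A.s₀ = proj3 A.V₀ := by
  have h := A.L3_deriv_chat A.s₀_mem_Iv
  rw [deriv_γ_s₀] at h
  have := congrArg proj3 h
  simpa using this

/-- `L3 ĉ'(s₀) = ċ(s₀)`. [folklore] -/
theorem L3_deriv_chat_s₀ : L3 (deriv A.chat A.s₀) = A.V₀ := by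
  rw [A.L3_deriv_chat A.s₀_mem_Iv, deriv_γ_s₀]

/-- At the centre of the chart, `α̂` is `α`. [folklore] -/
theorem αhat_chart_p (v : Fin 1 → E4) : A.αhat (A.chart A.p) v = αM S A.p v := by
  rw [αhat, chart, MForm.inChart_apply_self]
  rfl

/-- `αc 0 v = α_p(0, v)`. [folklore] -/
theorem αc_zero_apply (v : E3) : A.αc 0 v = S.contactForm A.p (L3 v) := by
  rw [αc_apply, emb_zero, αhat_chart_p]; rfl

/-- **`αc₀(u₀) = 0`** (`J ċ ∈ ξ`). [folklore] -/
theorem αc_zero_u₀ : A.αc 0 A.u₀ = 0 := by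
  rw [αc_zero_apply, L3_u₀]
  exact S.contactForm_apply_eq_zero A.isBoundaryPoint_p A.JV₀_mem

/-- `αc₀(ĉ'(s₀)) = 0`. [folklore] -/
theorem αc_zero_deriv_chat : A.αc 0 (deriv A.chat A.s₀) = 0 := by
  simpa using A.αc_chat_deriv A.s₀_mem_Iv

/-- The boundary tangent space `{v₀ = 0}` has dimension `3`. [folklore] -/
theorem finrank_boundaryTangentSpace : Module.finrank ℝ (boundaryTangentSpace) = 3 := by
  have h := LinearMap.finrank_range_add_finrank_ker
    ((EuclideanSpace.proj (0 : Fin 4) : E4 →L[ℝ] ℝ).toLinearMap)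
  have hr : LinearMap.range ((EuclideanSpace.proj (0 : Fin 4) : E4 →L[ℝ] ℝ).toLinearMap) = ⊤ := by
    rw [LinearMap.range_eq_top]
    intro c
    exact ⟨EuclideanSpace.single 0 c, by simp⟩
  rw [hr, finrank_top, Module.finrank_self, finrank_euclideanSpace_fin] at h
  change 1 + Module.finrank ℝ ↥boundaryTangentSpace = 4 at h
  omega

/-- **There is a boundary tangent vector on which the contact form is positive** (`T∂W` is
`3`-dimensional and the contact plane only `2`-dimensional). [folklore] -/
theorem exists_contactForm_pos : ∃ R : E4, R 0 = 0 ∧ 0 < S.contactForm A.p R := by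
  by_contra h
  push Not at h
  have hzero : ∀ R : E4, R 0 = 0 → S.contactForm A.p R = 0 := fun R hR => by
    have h1 := h R hR
    have h2 := h (-R) (by simp [hR])
    rw [map_neg] at h2
    linarith
  have hle : boundaryTangentSpace ≤ contactPlane S.J A.p := fun R hR =>
    S.mem_contactPlane_of_contactForm_eq_zero A.isBoundaryPoint_p hR (hzero R hR)
  have := Submodule.finrank_mono hle
  rw [finrank_boundaryTangentSpace, S.finrank_contactPlane] at this
  omega

/-- A boundary tangent vector with `α_p(R₀) > 0`. [folklore] -/
def R₀ : E4 := Classical.choose A.exists_contactForm_pos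

/-- `R₀` is tangent to the boundary. [folklore] -/
theorem R₀_apply_zero : A.R₀ 0 = 0 := (Classical.choose_spec A.exists_contactForm_pos).1

/-- `α_p(R₀) > 0`. [folklore] -/
theorem contactForm_R₀_pos : 0 < S.contactForm A.p A.R₀ := (Classical.choose_spec A.exists_contactForm_pos).2

/-- **`r₀`**: the transverse vector read in `ℝ³`. [folklore] -/
def r₀ : E3 := proj3 A.R₀

/-- `L3 r₀ = R₀`. [folklore] -/
theorem L3_r₀ : L3 A.r₀ = A.R₀ := L3_proj3 A.R₀_apply_zero

/-- **`αc₀(r₀) > 0`.** [folklore] -/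
theorem αc_zero_r₀_pos : 0 < A.αc 0 A.r₀ := by
  rw [αc_zero_apply, L3_r₀]; exact A.contactForm_R₀_pos

/-! ### The contact condition: `dα` at the base point -/

/-- The pulled-back `1`-form `x ↦ α̂_{emb x} ∘ L3` on `ℝ³`. [folklore] -/
def αpull (x : E3) : E3 [⋀^Fin 1]→L[ℝ] ℝ := (A.αhat (A.emb x)).compContinuousLinearMap L3

/-- The pulled-back form is the `1`-form of `αc`. [folklore] -/
theorem αpull_eq (x : E3) :
    A.αpull x = ContinuousAlternatingMap.ofSubsingleton ℝ E3 ℝ (0 : Fin 1) (A.αc x) := by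
  rw [αc, Equiv.apply_symm_apply]; rfl

/-! ### Smoothness of the contact form in the chart and the contact condition (Hausdorff `W`) -/

section Smooth

variable [T2Space W]

/-- The contact form is a smooth `1`-form. [folklore] -/
theorem isSmoothForm_αM : IsSmoothForm (αM S) := S.isSmoothForm_liouvilleForm

/-- `α̂` is `C^∞` within the half-space at every point of the chart target. [folklore] -/
theorem contDiffWithinAt_αhat {y : E4} (hy : y ∈ A.chart.target) :
    ContDiffWithinAt ℝ ∞ A.αhat (range (𝓡∂ 4)) y := by
  have hz : A.chart.symm y ∈ (extChartAt (𝓡∂ 4) A.p).source := A.chart.map_target hy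
  have h := MForm.SmoothAt.contDiffWithinAt_inChart (α := αM S) (I := 𝓡∂ 4) hz
    ((isSmoothForm_iff_smoothAt _).1 isSmoothForm_αM _)
  rwa [show extChartAt (𝓡∂ 4) A.p (A.chart.symm y) = y from A.chart.right_inv hy] at h

/-- `αc` is smooth on `U`. [folklore] -/
theorem contDiffAt_αc {w : E3} (hw : w ∈ A.U) : ContDiffAt ℝ ∞ A.αc w := by
  have h1 : ContDiffAt ℝ ∞ (fun w => A.αhat (A.emb w)) w := by
    have := (A.contDiffWithinAt_αhat hw).comp (s := univ) w A.contDiff_emb.contDiffAt.contDiffWithinAt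
      (fun x _ => A.emb_mem_range x)
    exact this.contDiffAt Filter.univ_mem
  have h2 : ContDiffAt ℝ ∞ (fun w => ContinuousAlternatingMap.compContinuousLinearMapCLM L3
      (A.αhat (A.emb w))) w :=
    (ContinuousAlternatingMap.compContinuousLinearMapCLM (ι := Fin 1) (F := ℝ) L3).contDiff.contDiffAt.comp
      w h1
  exact (ContinuousAlternatingMap.ofSubsingletonLIE (𝕜 := ℝ) (E := E3) (F := ℝ) (ι := Fin 1)
    0).symm.toContinuousLinearEquiv.contDiff.contDiffAt.comp w h2

/-- `αc` is smooth on `U`. [folklore] -/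
theorem contDiffOn_αc : ContDiffOn ℝ ∞ A.αc A.U := fun _ hw => (A.contDiffAt_αc hw).contDiffWithinAt

/-- The Kähler form at the base point is the exterior derivative of `α̂` within the half-space.
[folklore] -/
theorem kahlerForm_eq_extDerivWithin (a b : E4) :
    S.kahlerForm A.p a b = extDerivWithin A.αhat (range (𝓡∂ 4)) (A.chart A.p) ![a, b] := by
  have hy : A.chart A.p ∈ (extChartAt (𝓡∂ 4) A.p).target := mem_extChartAt_target _
  have hsm : (αM S).SmoothAt ((extChartAt (𝓡∂ 4) A.p).symm (A.chart A.p)) :=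
    (isSmoothForm_iff_smoothAt _).1 isSmoothForm_αM _
  have h := inChart_mextDeriv_of_mem_target (αM S) (I := 𝓡∂ 4) hy hsm
  have h2 := MForm.inChart_apply_self (mextDeriv (αM S)) (I := 𝓡∂ 4) A.p
  have h3 : mextDeriv (αM S) A.p = extDerivWithin A.αhat (range (𝓡∂ 4)) (A.chart A.p) :=
    h2.symm.trans h
  have h4 : S.kahlerForm A.p a b = mextDeriv (αM S) A.p ![a, b] :=
    (SteinStructure.mextDeriv_liouvilleForm_apply S A.p a b).symm
  rw [h4, h3]
  rfl

/-- **Naturality of `d` under the affine embedding**: the exterior derivative of the pulled-back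
form at `0` is the exterior derivative of `α̂` within the half-space at `chart p`, on embedded
vectors. [folklore] -/
theorem extDeriv_αpull_zero (u v : E3) :
    extDeriv A.αpull 0 ![u, v] = extDerivWithin A.αhat (range (𝓡∂ 4)) (A.chart A.p) ![L3 u, L3 v] := by
  have hdiff : DifferentiableWithinAt ℝ A.αhat (range (𝓡∂ 4)) (A.emb 0) :=
    (A.contDiffWithinAt_αhat A.zero_mem_U).differentiableWithinAt (by simp)
  have h := extDerivWithin_pullback (𝕜 := ℝ) (n := 1) (r := ∞) (s := univ) (x := (0 : E3))
    (t := range (𝓡∂ 4)) (f := A.emb) hdiff A.contDiff_emb.contDiffAt.contDiffWithinAt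
    (by rw [minSmoothness_of_isRCLikeNormedField]; exact WithTop.coe_le_coe.2 le_top)
    uniqueDiffOn_univ (by simp) (mem_univ _) (fun x _ => A.emb_mem_range x)
  simp only [fderivWithin_univ, extDerivWithin_univ, (A.hasFDerivAt_emb _).fderiv] at h
  have h1 : (fun x => (A.αhat (A.emb x)).compContinuousLinearMap L3) = A.αpull := rfl
  rw [h1] at h
  rw [h, ContinuousAlternatingMap.compContinuousLinearMap_apply, emb_zero]
  congr 1
  funext i; fin_cases i <;> rfl

/-- **The contact condition at the base point**: `dαc₀(ĉ'(s₀), u₀) = ω_p(ċ, Jċ)`. [folklore] -/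
theorem dα_αc_zero : dα A.αc 0 (deriv A.chat A.s₀) A.u₀ = S.kahlerForm A.p A.V₀ (S.J A.p A.V₀) := by
  have hd : DifferentiableAt ℝ A.αc 0 := (A.contDiffAt_αc A.zero_mem_U).differentiableAt (by simp)
  rw [← DarbouxData.extDeriv_form1_apply hd]
  have hf : DarbouxData.form1 A.αc = A.αpull := by
    funext x; rw [αpull_eq]; rfl
  rw [hf, extDeriv_αpull_zero, L3_deriv_chat_s₀, L3_u₀, kahlerForm_eq_extDerivWithin]

/-- **The contact condition**: `dαc₀(ĉ'(s₀), u₀) > 0` (`J`-convexity `ω(v, Jv) > 0`). [folklore] -/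
theorem twist_pos : 0 < dα A.αc 0 (deriv A.chat A.s₀) A.u₀ := by
  rw [dα_αc_zero]; exact S.kahlerForm_self_J_pos _ A.V₀_ne_zero

/-- **The Darboux data of a Legendrian arc in the boundary of a Stein domain.** [folklore] -/
def darbouxData : DarbouxData where
  U := A.U
  isOpen_U := A.isOpen_U
  zero_mem := A.zero_mem_U
  α := A.αc
  α_smooth := A.contDiffOn_αc
  c := A.chat
  s₀ := A.s₀
  δ := A.δ
  δ_pos := A.δ_pos
  c_smooth := A.contDiffOn_chat
  c_mem := fun _ hs => A.chat_mem_U hs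
  c_s₀ := A.chat_s₀
  legendrian := fun _ hs => A.αc_chat_deriv hs
  u₀ := A.u₀
  r₀ := A.r₀
  α_u₀ := A.αc_zero_u₀
  α_r₀ := A.αc_zero_r₀_pos
  twist := A.twist_pos

/-- Unfolding. [folklore] -/
@[simp] theorem darbouxData_U : A.darbouxData.U = A.U := rfl

/-- Unfolding. [folklore] -/
@[simp] theorem darbouxData_α : A.darbouxData.α = A.αc := rfl

/-- Unfolding. [folklore] -/
@[simp] theorem darbouxData_c : A.darbouxData.c = A.chat := rfl

/-- Unfolding. [folklore] -/
@[simp] theorem darbouxData_s₀ : A.darbouxData.s₀ = A.s₀ := rfl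

end Smooth

end LegendrianArc

end LegendrianDarboux

end Literature.Geometry.Symplectic

end
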